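import Literature.Analysis.SpecialFunctions.GammaRatioStirling
import Literature.Analysis.SpecialFunctions.DigammaGauss
import Literature.Analysis.SpecialFunctions.DigammaLogBound
import HarnessLib

/-!
# A sharp bound for the horizontal `Γ`-ratio: `‖Γ(z+h)‖ ≤ ‖Γ(z)‖ ‖z‖^h e^{O(h/(1+|Im z|))}`

Topic `Literature/Analysis/SpecialFunctions` (companion of `GammaVerticalRatio.lean`, which proves
the cruder `‖Γ(x+δ+iu)‖ ≤ K(x₀)(1+|u|)^δ‖Γ(x+iu)‖`). Everything here is PROVED; no definitions, no
named facts.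

For `0 < x₀ ≤ Re z ≤ 1` and `0 ≤ h ≤ 1/2`,

  `‖Γ(z + h)‖ ≤ ‖Γ(z)‖ · ‖z‖^h · exp(C(x₀) h/(1 + |Im z|))`      (`exists_norm_Gamma_add_le`),

i.e. Stirling's `|Γ(z+h)/Γ(z)| = |z|^h e^{O(h/|z|)}` in one-sided form with the error proportional
to `h`, which is what makes `∫ (|Γ((s+ε)/2)/Γ(s/2)|² |s/2|^{-ε} − 1) dτ/|s|² = O(ε)`. This is
inequality (t10) of M. Balazard, A. de Roton, *Sur un critère de Báez-Duarte pour l'hypothèse de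
Riemann*, Int. J. Number Theory 6 (2010), §3 ("qui résulte de la formule de Stirling complexe"), an
input of their Proposition 4 (ii).

## Proof

* `Im z ≥ 1` (`norm_Gamma_add_le_of_one_le_im`; `Im z ≤ −1` by conjugation):
  `Γ(z+h) = Γ(z) exp(∫₀¹ ψ(z+th) h dt)`
  (`Literature.Analysis.SpecialFunctions.Complex.Gamma_eq_mul_exp_integral_digamma`) and
  `Re ψ(w) ≤ log‖w‖ + 1/(2‖w‖²) + π/(4|Im w|)`
  (`Literature.Analysis.SpecialFunctions.Complex.abs_re_digamma_sub_log_norm_le`), with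
  `log‖z+th‖ ≤ log‖z‖ + h/‖z‖`, give `Re ∫ ≤ h log‖z‖ + 2h/Im z`.
* `|Im z| ≤ 1` (`exists_norm_Gamma_add_le_of_abs_im_le`): on the compact box
  `[x₀, 3/2] × [−1, 1]`, `‖Γ'‖ ≤ M` and `‖Γ‖ ≥ m > 0`, so by the mean value inequality
  `‖Γ(z+h)‖ ≤ ‖Γ(z)‖ + Mh ≤ ‖Γ(z)‖ e^{(M/m)h}`, and `‖z‖^h ≥ x₀^h`.

## References

* [BalazardDeRoton2010] M. Balazard, A. de Roton, Int. J. Number Theory 6 (2010) 883–903, §3 (t10).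
* [WhittakerWatson1927] E. T. Whittaker, G. N. Watson, *A Course of Modern Analysis*, 4th ed.,
  §12.33, §13.6 (Stirling / Binet for `log Γ`).
-/

noncomputable section

open Complex Filter Topology Set MeasureTheory intervalIntegral
open scoped Real

namespace Literature.Analysis.SpecialFunctions

namespace GammaShift

open Literature.Analysis.SpecialFunctions.Complex

/-! ## The range `Im z ≥ 1`: the `ψ`-integral -/

/-- For `Im z ≥ 1`, `0 ≤ h ≤ 1/2`, `0 ≤ t ≤ 1` and `Re z > 0`:
`Re ψ(z + th) ≤ log ‖z‖ + 2/Im z`. [folklore] -/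
lemma re_digamma_add_le {z : ℂ} (hz : 0 < z.re) (hzi : 1 ≤ z.im) {h t : ℝ} (hh : 0 ≤ h)
    (hh1 : h ≤ 1 / 2) (ht0 : 0 ≤ t) (ht1 : t ≤ 1) :
    (digamma (z + t * h)).re ≤ Real.log ‖z‖ + 2 / z.im := by
  set w : ℂ := z + t * h with hw
  have hwre : 0 < w.re := by simp [hw]; positivity
  have hwim : w.im = z.im := by simp [hw]
  have hy0 : 0 < z.im := by linarith
  have hzn : z.im ≤ ‖z‖ := (le_abs_self _).trans (abs_im_le_norm z)
  have hwn : z.im ≤ ‖w‖ := hwim ▸ (le_abs_self _).trans (abs_im_le_norm w)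
  have hz0 : 0 < ‖z‖ := hy0.trans_le hzn
  have hw0 : 0 < ‖w‖ := hy0.trans_le hwn
  have hψ := abs_re_digamma_sub_log_norm_le hwre (by rw [hwim]; exact hy0.ne')
  rw [hwim, abs_of_pos hy0] at hψ
  have h1 : (digamma w).re ≤ Real.log ‖w‖ + 1 / (2 * ‖w‖ ^ 2) + π / (4 * z.im) := by
    have := (abs_le.mp hψ).2; linarith
  -- `log ‖w‖ ≤ log ‖z‖ + h/‖z‖ ≤ log‖z‖ + h/Im z`
  have h2 : Real.log ‖w‖ ≤ Real.log ‖z‖ + h / z.im := by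
    have hle : ‖w‖ ≤ ‖z‖ + t * h := by
      refine (norm_add_le _ _).trans (add_le_add le_rfl ?_)
      rw [← ofReal_mul, Complex.norm_real, Real.norm_eq_abs, abs_of_nonneg (by positivity)]
    have hlog : Real.log (‖z‖ + t * h) ≤ Real.log ‖z‖ + t * h / ‖z‖ := by
      -- `log(a+b) - log a = log((a+b)/a) ≤ (a+b)/a - 1 = b/a` (tree: cf. `SchoenfeldBound.log_add_le`)
      have := Real.log_le_sub_one_of_pos (show 0 < (‖z‖ + t * h) / ‖z‖ by positivity)
      rw [Real.log_div (by positivity) hz0.ne'] at this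
      have e : (‖z‖ + t * h) / ‖z‖ - 1 = t * h / ‖z‖ := by field_simp; ring
      linarith
    calc Real.log ‖w‖ ≤ Real.log (‖z‖ + t * h) := Real.log_le_log hw0 hle
      _ ≤ Real.log ‖z‖ + t * h / ‖z‖ := hlog
      _ ≤ Real.log ‖z‖ + h / z.im := by
          gcongr
          · nlinarith
  -- `1/(2‖w‖²) ≤ 1/(2 Im z)` and `π/4 ≤ 1`
  have h3 : 1 / (2 * ‖w‖ ^ 2) ≤ 1 / (2 * z.im) := by
    refine div_le_div_of_nonneg_left zero_le_one (by positivity) ?_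
    nlinarith
  have h4 : π / (4 * z.im) ≤ 1 / z.im := by
    rw [div_le_div_iff₀ (by positivity) hy0]
    nlinarith [Real.pi_lt_four]
  have h5 : h / z.im ≤ 1 / (2 * z.im) := by
    rw [div_le_div_iff₀ hy0 (by positivity)]
    nlinarith
  have e : 1 / (2 * z.im) + 1 / (2 * z.im) + 1 / z.im = 2 / z.im := by field_simp; ring
  linarith

/-- **The range `Im z ≥ 1`.** For `Re z > 0`, `Im z ≥ 1` and `0 ≤ h ≤ 1/2`:
`‖Γ(z + h)‖ ≤ ‖Γ(z)‖ ‖z‖^h exp(2h/Im z)`. [cite: BalazardDeRoton2010, §3 (t10)] -/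
theorem norm_Gamma_add_le_of_one_le_im {z : ℂ} (hz : 0 < z.re) (hzi : 1 ≤ z.im) {h : ℝ}
    (hh : 0 ≤ h) (hh1 : h ≤ 1 / 2) :
    ‖Gamma (z + h)‖ ≤ ‖Gamma z‖ * ‖z‖ ^ h * Real.exp (2 * h / z.im) := by
  have hy0 : 0 < z.im := by linarith
  have hz0 : 0 < ‖z‖ := hy0.trans_le ((le_abs_self _).trans (abs_im_le_norm z))
  have him : 0 < (z + h).im := by simp; linarith
  rw [Gamma_eq_mul_exp_integral_digamma hy0 him, add_sub_cancel_left, norm_mul, Complex.norm_exp,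
    mul_assoc]
  refine mul_le_mul_of_nonneg_left ?_ (norm_nonneg _)
  rw [Real.rpow_def_of_pos hz0, ← Real.exp_add, Real.exp_le_exp]
  -- the integrand is continuous
  have hcont : ContinuousOn (fun τ : ℝ ↦ digamma (z + τ * h) * h) (Icc 0 1) := by
    refine ContinuousOn.mul ?_ continuousOn_const
    refine continuousOn_digamma.comp (by fun_prop) fun τ hτ ↦ ?_
    show 0 < (z + τ * h).re
    simp; nlinarith [hτ.1]
  have hint : IntervalIntegrable (fun τ : ℝ ↦ digamma (z + τ * h) * h) volume 0 1 :=
    hcont.intervalIntegrable_of_Icc zero_le_one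
  -- real part of the integral
  have hre : (∫ τ : ℝ in (0 : ℝ)..1, digamma (z + τ * h) * h).re =
      ∫ τ : ℝ in (0 : ℝ)..1, (digamma (z + τ * h) * h).re := by
    have := (reCLM.intervalIntegral_comp_comm hint).symm
    simpa using this
  rw [hre]
  have hbound : ∀ τ ∈ Icc (0 : ℝ) 1, (digamma (z + τ * h) * h).re ≤
      Real.log ‖z‖ * h + 2 * h / z.im := by
    intro τ hτ
    rw [mul_comm, re_ofReal_mul]
    have := re_digamma_add_le hz hzi hh hh1 hτ.1 hτ.2
    have hzim := hy0
    calc h * (digamma (z + τ * h)).re ≤ h * (Real.log ‖z‖ + 2 / z.im) :=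
          mul_le_mul_of_nonneg_left this hh
      _ = Real.log ‖z‖ * h + 2 * h / z.im := by ring
  calc ∫ τ : ℝ in (0 : ℝ)..1, (digamma (z + τ * h) * h).re
      ≤ ∫ _ in (0 : ℝ)..1, (Real.log ‖z‖ * h + 2 * h / z.im) :=
        intervalIntegral.integral_mono_on zero_le_one
          ((reCLM.continuous.comp_continuousOn hcont).intervalIntegrable_of_Icc zero_le_one)
          intervalIntegrable_const hbound
    _ = Real.log ‖z‖ * h + 2 * h / z.im := by simp

/-- The same for `Im z ≤ −1`, by `Γ(w̄) = conj Γ(w)`: for `Re z > 0`, `|Im z| ≥ 1`, `0 ≤ h ≤ 1/2`,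
`‖Γ(z + h)‖ ≤ ‖Γ(z)‖ ‖z‖^h exp(2h/|Im z|)`. [cite: BalazardDeRoton2010, §3 (t10)] -/
theorem norm_Gamma_add_le_of_one_le_abs_im {z : ℂ} (hz : 0 < z.re) (hzi : 1 ≤ |z.im|) {h : ℝ}
    (hh : 0 ≤ h) (hh1 : h ≤ 1 / 2) :
    ‖Gamma (z + h)‖ ≤ ‖Gamma z‖ * ‖z‖ ^ h * Real.exp (2 * h / |z.im|) := by
  rcases le_or_gt 0 z.im with hpos | hneg
  · rw [abs_of_nonneg hpos] at hzi ⊢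
    exact norm_Gamma_add_le_of_one_le_im hz hzi hh hh1
  · set z' : ℂ := starRingEnd ℂ z with hz'
    have hre : z'.re = z.re := by simp [hz']
    have him : z'.im = -z.im := by simp [hz']
    have habs : |z.im| = z'.im := by rw [him, abs_of_neg hneg]
    have h1 : 1 ≤ z'.im := habs ▸ hzi
    have key := norm_Gamma_add_le_of_one_le_im (by rw [hre]; exact hz) h1 hh hh1
    have e1 : z + h = starRingEnd ℂ (z' + h) := by simp [hz']
    rw [e1, Complex.Gamma_conj, Complex.norm_conj, habs]
    have e2 : ‖Gamma z'‖ = ‖Gamma z‖ := by rw [hz', Complex.Gamma_conj, Complex.norm_conj]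
    have e3 : ‖z'‖ = ‖z‖ := by rw [hz', Complex.norm_conj]
    rwa [e2, e3] at key

/-! ## The range `|Im z| ≤ 1`: compactness and the mean value inequality -/

/-- **The range `|Im z| ≤ 1`.** For `0 < x₀ ≤ 1` there is `C ≥ 0` with
`‖Γ(z + h)‖ ≤ ‖Γ(z)‖ ‖z‖^h exp(C h)` for `x₀ ≤ Re z ≤ 1`, `|Im z| ≤ 1`, `0 ≤ h ≤ 1/2`
(`Γ'` is bounded and `|Γ|` is bounded below on the box `[x₀, 3/2] × [−1, 1]`). [folklore] -/
theorem exists_norm_Gamma_add_le_of_abs_im_le {x₀ : ℝ} (hx₀ : 0 < x₀) (hx₀1 : x₀ ≤ 1) :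
    ∃ C : ℝ, 0 ≤ C ∧ ∀ z : ℂ, x₀ ≤ z.re → z.re ≤ 1 → |z.im| ≤ 1 → ∀ h : ℝ, 0 ≤ h → h ≤ 1 / 2 →
      ‖Gamma (z + h)‖ ≤ ‖Gamma z‖ * ‖z‖ ^ h * Real.exp (C * h) := by
  set K : Set ℂ := Icc x₀ (3 / 2) ×ℂ Icc (-1) 1 with hKdef
  have hK : IsCompact K := isCompact_Icc.reProdIm isCompact_Icc
  have hKU : K ⊆ {w : ℂ | 0 < w.re} := fun w hw ↦ hx₀.trans_le hw.1.1
  have hU : IsOpen {w : ℂ | 0 < w.re} := isOpen_lt continuous_const Complex.continuous_re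
  have hdiff : DifferentiableOn ℂ Gamma {w : ℂ | 0 < w.re} := by
    intro w hw
    refine (Complex.differentiableAt_Gamma w fun m hm ↦ ?_).differentiableWithinAt
    have : w.re = -m := by rw [hm]; simp
    have hw' : 0 < w.re := hw
    have hm0 : (0 : ℝ) ≤ m := Nat.cast_nonneg m
    linarith
  have han : AnalyticOnNhd ℂ Gamma {w : ℂ | 0 < w.re} := hdiff.analyticOnNhd hU
  obtain ⟨M, hM⟩ := hK.exists_bound_of_continuousOn (han.deriv.continuousOn.mono hKU)
  have hcinv : ContinuousOn (fun w ↦ (Gamma w)⁻¹) K :=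
    (han.continuousOn.mono hKU).inv₀ fun w hw ↦ Complex.Gamma_ne_zero_of_re_pos (hKU hw)
  obtain ⟨M', hM'⟩ := hK.exists_bound_of_continuousOn hcinv
  set M₀ : ℝ := max M 0 with hM₀
  set M₀' : ℝ := max M' 0 with hM₀'
  have hlog : Real.log x₀ ≤ 0 := Real.log_nonpos hx₀.le hx₀1
  refine ⟨M₀ * M₀' - Real.log x₀, by
    have : 0 ≤ M₀ * M₀' := mul_nonneg (le_max_right _ _) (le_max_right _ _)
    linarith, fun z hzre hzre1 hzim h hh hh1 ↦ ?_⟩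
  -- the segment `[z, z+h]` lies in `K`
  have hseg : segment ℝ z (z + h) ⊆ K := by
    rw [segment_eq_image']
    rintro w ⟨θ, hθ, rfl⟩
    simp only [add_sub_cancel_left]
    refine ⟨⟨?_, ?_⟩, ?_⟩
    · simp; nlinarith [hθ.1]
    · simp; nlinarith [hθ.2]
    · simpa using abs_le.mp hzim
  have hzK : z ∈ K := hseg (left_mem_segment ℝ z (z + h))
  -- mean value inequality
  have hMVT : ‖Gamma (z + h) - Gamma z‖ ≤ M₀ * ‖(z + h : ℂ) - z‖ :=
    (convex_segment z (z + ↑h)).norm_image_sub_le_of_norm_deriv_le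
      (fun w hw ↦ (hdiff _ (hKU (hseg hw))).differentiableAt (hU.mem_nhds (hKU (hseg hw))))
      (fun w hw ↦ (hM w (hseg hw)).trans (le_max_left _ _))
      (left_mem_segment ℝ z (z + h)) (right_mem_segment ℝ z (z + h))
  rw [add_sub_cancel_left, Complex.norm_real, Real.norm_eq_abs, abs_of_nonneg hh] at hMVT
  -- lower bound for `‖Γ z‖`
  have hG0 : Gamma z ≠ 0 := Complex.Gamma_ne_zero_of_re_pos (hKU hzK)
  have hGpos : 0 < ‖Gamma z‖ := norm_pos_iff.mpr hG0
  have hinv : 1 ≤ ‖Gamma z‖ * M₀' := by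
    have h1 : ‖(Gamma z)⁻¹‖ ≤ M₀' := (hM' z hzK).trans (le_max_left _ _)
    rw [norm_inv] at h1
    calc (1 : ℝ) = ‖Gamma z‖ * ‖Gamma z‖⁻¹ := by field_simp
      _ ≤ ‖Gamma z‖ * M₀' := mul_le_mul_of_nonneg_left h1 hGpos.le
  -- `‖Γ(z+h)‖ ≤ ‖Γ z‖ (1 + M₀ M₀' h) ≤ ‖Γ z‖ exp (M₀ M₀' h)`
  have hstep : ‖Gamma (z + h)‖ ≤ ‖Gamma z‖ * Real.exp (M₀ * M₀' * h) := by
    have hM₀0 : 0 ≤ M₀ := le_max_right _ _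
    calc ‖Gamma (z + h)‖ ≤ ‖Gamma z‖ + ‖Gamma (z + h) - Gamma z‖ := norm_le_insert' _ _
      _ ≤ ‖Gamma z‖ + M₀ * h := add_le_add le_rfl hMVT
      _ ≤ ‖Gamma z‖ + M₀ * h * (‖Gamma z‖ * M₀') :=
          add_le_add le_rfl (le_mul_of_one_le_right (by positivity) hinv)
      _ = ‖Gamma z‖ * (1 + M₀ * M₀' * h) := by ring
      _ ≤ ‖Gamma z‖ * Real.exp (M₀ * M₀' * h) := by
          gcongr
          linarith [Real.add_one_le_exp (M₀ * M₀' * h)]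
  -- `x₀^h ≤ ‖z‖^h`
  have hz0 : x₀ ≤ ‖z‖ := hzre.trans (Complex.re_le_norm z)
  have hzpow : Real.exp (h * Real.log x₀) ≤ ‖z‖ ^ h := by
    rw [mul_comm, ← Real.rpow_def_of_pos hx₀]
    exact Real.rpow_le_rpow hx₀.le hz0 hh
  calc ‖Gamma (z + h)‖ ≤ ‖Gamma z‖ * Real.exp (M₀ * M₀' * h) := hstep
    _ = ‖Gamma z‖ * Real.exp (h * Real.log x₀) *
          Real.exp ((M₀ * M₀' - Real.log x₀) * h) := by
        rw [mul_assoc (‖Gamma z‖), ← Real.exp_add]; congr 1; congr 1; ring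
    _ ≤ ‖Gamma z‖ * ‖z‖ ^ h * Real.exp ((M₀ * M₀' - Real.log x₀) * h) := by gcongr

/-! ## The bound on the whole strip -/

/-- **Sharp horizontal `Γ`-ratio bound** (Balazard–de Roton (t10),
`|Γ((s+ε)/2)/Γ(s/2)| ≤ |s/2|^{ε/2} exp(O(ε/|s|))`, in the strip `0 < x₀ ≤ Re z ≤ 1`): there is
`C = C(x₀) ≥ 0` with
`‖Γ(z + h)‖ ≤ ‖Γ(z)‖ ‖z‖^h exp(C h/(1 + |Im z|))` for `x₀ ≤ Re z ≤ 1`, `0 ≤ h ≤ 1/2`.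
[cite: BalazardDeRoton2010, §3 (t10)] -/
theorem exists_norm_Gamma_add_le {x₀ : ℝ} (hx₀ : 0 < x₀) (hx₀1 : x₀ ≤ 1) :
    ∃ C : ℝ, 0 ≤ C ∧ ∀ z : ℂ, x₀ ≤ z.re → z.re ≤ 1 → ∀ h : ℝ, 0 ≤ h → h ≤ 1 / 2 →
      ‖Gamma (z + h)‖ ≤ ‖Gamma z‖ * ‖z‖ ^ h * Real.exp (C * h / (1 + |z.im|)) := by
  obtain ⟨C₁, hC₁, h₁⟩ := exists_norm_Gamma_add_le_of_abs_im_le hx₀ hx₀1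
  refine ⟨max 4 (2 * C₁), le_max_of_le_left (by norm_num), fun z hzre hzre1 h hh hh1 ↦ ?_⟩
  have hz : 0 < z.re := hx₀.trans_le hzre
  have hmono : ∀ {a : ℝ}, a ≤ max 4 (2 * C₁) * h / (1 + |z.im|) →
      ‖Gamma z‖ * ‖z‖ ^ h * Real.exp a ≤
        ‖Gamma z‖ * ‖z‖ ^ h * Real.exp (max 4 (2 * C₁) * h / (1 + |z.im|)) :=
    fun ha ↦ by gcongr
  rcases le_or_gt 1 |z.im| with him | him
  · refine (norm_Gamma_add_le_of_one_le_abs_im hz him hh hh1).trans (hmono ?_)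
    -- `2h/|Im z| ≤ 4h/(1+|Im z|)`
    rw [div_le_div_iff₀ (by positivity) (by positivity)]
    have : (4 : ℝ) * h ≤ max 4 (2 * C₁) * h := mul_le_mul_of_nonneg_right (le_max_left _ _) hh
    nlinarith [abs_nonneg z.im]
  · refine (h₁ z hzre hzre1 him.le h hh hh1).trans (hmono ?_)
    -- `C₁ h ≤ 2C₁h/(1+|Im z|)`
    rw [le_div_iff₀ (by positivity)]
    have : 2 * C₁ * h ≤ max 4 (2 * C₁) * h := mul_le_mul_of_nonneg_right (le_max_right _ _) hh
    nlinarith [abs_nonneg z.im, mul_nonneg hC₁ hh]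

end GammaShift

end Literature.Analysis.SpecialFunctions

end
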